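import Summits.CriticalPhenomena.PercolationContinuityZ3.Theorems.Transplant.FKConnectivityAllQAntipodalPrune
import Summits.CriticalPhenomena.PercolationContinuityZ3.Theorems.Transplant.FKConnectivityAllQAntipodalOneSum
import HarnessLib

/-!
# Connectivity correlation inequalities for `φ_{w,q}`, every `q > 0` — file 39: **THEOREM U, AND, U¹¹ IN EVERY DELETION CELL**
# (every square-free coefficient) of a 2-connected series–parallel graph

Support file (`--supports stmt-CriticalPhenomena-4575`), FK sub-lane `prim-bschramm-fk-2` (gen 20); builds on p205010 (kernel theorem,
internal audit signed; external expert review pending).  No definitions, no named facts, no sorries; standard axioms.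

A square-free coefficient `[z^{1_M}] Z_H² Cov_{φ_{z,q}}(f, g)` of the host `H = E ∪ {st}` is the antipodal form of the LIVE sub-host
`M ⊆ H` (the other edges deleted).  This file proves, for `0 < q ≤ 1` and EVERY `M ⊆ H`:
* `FK.apPsi_pivot_sub_nonpos_of_isTTSP` — Theorem U at any edge `a ∈ M` (gen 11's `FK.apPsi_edge_nonpos_of_isTTSP` after re-rooting);
* `FK.apPsi_andSet_sub_nonpos_of_isTTSP` — `and_S` for any `∅ ≠ S ⊆ M` (file 32c's master theorem after re-rooting);
* **`FK.apPsi_pivot_split_sub_nonpos_of_isTTSP`** — U¹¹ at any pivot `a ∈ M` and split pair `b ≠ c ∈ M ∖ {a}`: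
  `apPsi q M 1_a (split_{bc}·g) ≤ 0` for `g` increasing on the subsets of `M` reading none of `a, b, c`.
  Proof: re-root at `a`; PRUNE the live set to its core `L'` (file 38, `FK.prune`): the dangling part `P = L ∖ L'` folds into the test
  function with ONE antipodal weight; if the core is empty the form vanishes; otherwise four cases — `b, c ∈` core: the fold of `split·g`
  is `split·ĝ` and gen 16's U¹¹ applies on the smaller 2-connected host `L' ∪ {a}`; `b ∈` core, `c ∈ P` (or vice versa): the fold is
  `1{b∈β}G_out + 1{b∉β}G_in`, monotone because `G_in ≤ G_out` is Theorem U at `c` on the subgraph `P`; `b, c ∈ P`: the fold is monotone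
  outright; in the last three cases Theorem U at `a` on the core finishes (`FK.pivot_split_fold_nonpos*`).
So U¹¹ — hence `maj₃`, the thresholds on four edges and file 35's level ≤ 3 (file 40) — holds in EVERY SQUARE-FREE COEFFICIENT, as gen 10's
Conjecture `C_∞` asks; the contraction cells remain (planar duality on paper, memo `bschramm/FROM-fk-2-g20-LEVEL3-ONESUM.md` §2.6).
[cite: Grimmett2006, §1.4 eq. (1.20) (p. 15); §3.8 Thm. (3.90) (pp. 61–62); §3.9 (pp. 63–64)] [cite: Wagner2006, Thm. 5.8(d), §5.3]
-/

noncomputable section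

namespace Summit.CriticalPhenomena.PercolationContinuityZ3.Theorems

namespace FK

open Literature.Probability.LatticeModels Literature.Probability.Percolation
open scoped Classical

variable {V : Type*} [Fintype V] {s t : V}

omit [Fintype V] in
/-- The split indicator is symmetric in the two marked edges. [folklore] -/
theorem splitInd_comm (y z : Sym2 V) (A : Finset (Sym2 V)) : splitInd y z A = splitInd z y A := by
  unfold splitInd
  by_cases hy : y ∈ A <;> by_cases hz : z ∈ A <;> simp [hy, hz]

omit [Fintype V] in
/-- On the one-edge graph `{x}` the antipodal form against a test function not reading `x` vanishes. [folklore] -/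
theorem apPsi_single_eq_zero (q : ℝ) (x : Sym2 V) (f : Finset (Sym2 V) → ℝ) {G : Finset (Sym2 V) → ℝ} (hG : G {x} = G ∅) :
    apPsi q {x} f G = 0 := by
  unfold apPsi
  refine Finset.sum_eq_zero fun γ hγ => ?_
  rcases Finset.subset_singleton_iff.1 (Finset.mem_powerset.1 hγ) with rfl | rfl
  · rw [Finset.sdiff_empty, hG]; ring
  · rw [Finset.sdiff_self, hG]; ring

/-! ### Theorem U and AND in every deletion cell -/

/-- **Theorem U at any edge of any sub-host** (`0 < q ≤ 1`): `E` TTSP between `s, t`, `st ∉ E`, `M ⊆ E ∪ {st}`, `a ∈ M`, `g` monotone on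
the subsets of `M` not reading `a` ⟹ `apPsi q M 1_a g ≤ 0` (re-root `E ∪ {st}` at `a`, then gen 11's `FK.apPsi_edge_nonpos_of_isTTSP` with the
live set `M ∖ {a}`). [cite: Grimmett2006, §3.8 Thm. (3.90) (pp. 61–62); §3.9 (pp. 63–64)] -/
theorem apPsi_pivot_sub_nonpos_of_isTTSP {q : ℝ} (hq0 : 0 < q) (hq1 : q ≤ 1) {E : Finset (Sym2 V)} (hE : IsTTSP E s t)
    (hst : s(s, t) ∉ E) {M : Finset (Sym2 V)} (hM : M ⊆ insert s(s, t) E) {a : Sym2 V} (ha : a ∈ M)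
    {g : Finset (Sym2 V) → ℝ} (hga : ∀ A : Finset (Sym2 V), g (insert a A) = g A)
    (hmono : ∀ ⦃A B : Finset (Sym2 V)⦄, A ⊆ B → B ⊆ M → g A ≤ g B) :
    apPsi q M (fun A => if a ∈ A then 1 else 0) g ≤ 0 := by
  induction a using Sym2.ind with
  | h a₁ a₂ =>
    have hR := hE.reroot_erase (hM ha) (insert_ne_singleton_of_isTTSP hE hst _)
    have hMa : M.erase s(a₁, a₂) ⊆ (insert s(s, t) E).erase s(a₁, a₂) := Finset.erase_subset_erase _ hM
    have key := apPsi_edge_nonpos_of_isTTSP hq0 hq1 hR hMa (Finset.notMem_erase _ _) hga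
      (fun A B hAB hB => hmono hAB (hB.trans (Finset.erase_subset _ _)))
    rw [Finset.insert_erase ha] at key
    exact key

/-- **AND of any nonempty edge set in any sub-host** (`0 < q ≤ 1`): `M ⊆ E ∪ {st}`, `∅ ≠ S ⊆ M`, `g` monotone on the subsets of `M` not
reading `S` ⟹ `apPsi q M 1_{S ⊆ ·} g ≤ 0` (re-root at an edge of `S`; file 32c's `FK.apPsi_and_nonpos_of_isTTSP` with free set `M ∖ S`).
[cite: Grimmett2006, §3.8 Thm. (3.90) (pp. 61–62); §3.9 (pp. 63–64)] -/
theorem apPsi_andSet_sub_nonpos_of_isTTSP {q : ℝ} (hq0 : 0 < q) (hq1 : q ≤ 1) {E : Finset (Sym2 V)} (hE : IsTTSP E s t)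
    (hst : s(s, t) ∉ E) {M : Finset (Sym2 V)} (hM : M ⊆ insert s(s, t) E) {S : Finset (Sym2 V)} (hS : S ⊆ M) (hSne : S.Nonempty)
    {g : Finset (Sym2 V) → ℝ} (hg : ∀ e ∈ S, ∀ A : Finset (Sym2 V), g (insert e A) = g A)
    (hmono : ∀ ⦃X Y : Finset (Sym2 V)⦄, X ⊆ Y → Y ⊆ M → g X ≤ g Y) :
    apPsi q M (fun X => if S ⊆ X then 1 else 0) g ≤ 0 := by
  obtain ⟨a, ha⟩ := hSne
  induction a using Sym2.ind with
  | h a₁ a₂ =>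
    have hR := hE.reroot_erase (hM (hS ha)) (insert_ne_singleton_of_isTTSP hE hst _)
    have hT : S.erase s(a₁, a₂) ⊆ (insert s(s, t) E).erase s(a₁, a₂) := Finset.erase_subset_erase _ (hS.trans hM)
    have hN : M.erase s(a₁, a₂) \ S.erase s(a₁, a₂) ⊆ (insert s(s, t) E).erase s(a₁, a₂) :=
      Finset.sdiff_subset.trans (Finset.erase_subset_erase _ hM)
    have hSeq : insert s(a₁, a₂) (S.erase s(a₁, a₂)) = S := Finset.insert_erase ha
    have hMeq : (M.erase s(a₁, a₂) \ S.erase s(a₁, a₂)) ∪ insert s(a₁, a₂) (S.erase s(a₁, a₂)) = M := by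
      rw [Finset.union_insert, Finset.sdiff_union_of_subset (Finset.erase_subset_erase _ hS), Finset.insert_erase (hS ha)]
    have key := apPsi_and_nonpos_of_isTTSP hq0 hq1 hR (Finset.notMem_erase _ _) hN hT Finset.sdiff_disjoint
      (g := g) (fun A U hU => notRead_union hg U (fun e he => hSeq ▸ hU he) A)
      (fun X Y hXY hY => hmono hXY (hY.trans (Finset.sdiff_subset.trans (Finset.erase_subset _ _))))
    rw [hMeq, hSeq] at key
    exact key

/-! ### The folded U¹¹ functional: three positions of the split pair -/

section Folds

variable {M₁ P : Finset (Sym2 V)} {x y z : Sym2 V} {q : ℝ} {g : Finset (Sym2 V) → ℝ}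

omit [Fintype V] in
/-- Split pair in the core: the fold of `split_{yz}·g` over `P ∌ y, z` is `split_{yz}·ĝ`, and U¹¹ on the core applies. [folklore] -/
theorem pivot_split_fold_nonpos_core (hq : 0 ≤ q) (hyP : y ∉ P) (hzP : z ∉ P) (hPM : ∀ B : Finset (Sym2 V), B ⊆ M₁ → B ∪ P ⊆ M₁ ∪ P)
    (hU : ∀ h : Finset (Sym2 V) → ℝ, (∀ A : Finset (Sym2 V), h (insert x A) = h A) → (∀ A : Finset (Sym2 V), h (insert y A) = h A) →
      (∀ A : Finset (Sym2 V), h (insert z A) = h A) → (∀ ⦃A B : Finset (Sym2 V)⦄, A ⊆ B → B ⊆ M₁ → h A ≤ h B) →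
      apPsi q M₁ (fun A => if x ∈ A then 1 else 0) (fun A => splitInd y z A * h A) ≤ 0)
    (hgx : ∀ A : Finset (Sym2 V), g (insert x A) = g A) (hgy : ∀ A : Finset (Sym2 V), g (insert y A) = g A)
    (hgz : ∀ A : Finset (Sym2 V), g (insert z A) = g A)
    (hmono : ∀ ⦃A B : Finset (Sym2 V)⦄, A ⊆ B → B ⊆ M₁ ∪ P → g A ≤ g B) :
    apPsi q M₁ (fun A => if x ∈ A then 1 else 0)
      (fun β => ∑ δ ∈ P.powerset, q ^ apExp P δ * (splitInd y z (β ∪ δ) * g (β ∪ δ))) ≤ 0 := by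
  have hfold : (fun β : Finset (Sym2 V) => ∑ δ ∈ P.powerset, q ^ apExp P δ * (splitInd y z (β ∪ δ) * g (β ∪ δ))) =
      fun β => splitInd y z β * ∑ δ ∈ P.powerset, q ^ apExp P δ * g (β ∪ δ) := by
    funext β
    rw [Finset.mul_sum]
    refine Finset.sum_congr rfl fun δ hδ => ?_
    have hyδ : y ∉ δ := fun h => hyP (Finset.mem_powerset.1 hδ h)
    have hzδ : z ∉ δ := fun h => hzP (Finset.mem_powerset.1 hδ h)
    have hsp : splitInd y z (β ∪ δ) = splitInd y z β := by
      unfold splitInd; simp only [Finset.mem_union, hyδ, hzδ, or_false]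
    rw [hsp]; ring
  rw [hfold]
  exact hU _ (fun A => oneSumFold_insert q P hgx A) (fun A => oneSumFold_insert q P hgy A) (fun A => oneSumFold_insert q P hgz A)
    (fun A B hAB hB => Finset.sum_le_sum fun δ hδ => mul_le_mul_of_nonneg_left
      (hmono (Finset.union_subset_union hAB le_rfl) (hPM B hB |>.trans' (Finset.union_subset_union le_rfl
        (Finset.mem_powerset.1 hδ)))) (pow_nonneg hq _))

omit [Fintype V] in
/-- Split pair beyond the core: for `y, z ∈ P` (disjoint from `M₁`) the fold is monotone outright; Theorem U on `M₁` at `x`. [folklore] -/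
theorem pivot_split_fold_nonpos_far (hq : 0 ≤ q) (hxy : x ≠ y) (hxz : x ≠ z) (hyM : y ∉ M₁) (hzM : z ∉ M₁)
    (hPM : ∀ B : Finset (Sym2 V), B ⊆ M₁ → B ∪ P ⊆ M₁ ∪ P)
    (hU : ∀ h : Finset (Sym2 V) → ℝ, (∀ A : Finset (Sym2 V), h (insert x A) = h A) →
      (∀ ⦃A B : Finset (Sym2 V)⦄, A ⊆ B → B ⊆ M₁ → h A ≤ h B) → apPsi q M₁ (fun A => if x ∈ A then 1 else 0) h ≤ 0)
    (hgx : ∀ A : Finset (Sym2 V), g (insert x A) = g A)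
    (hmono : ∀ ⦃A B : Finset (Sym2 V)⦄, A ⊆ B → B ⊆ M₁ ∪ P → g A ≤ g B) :
    apPsi q M₁ (fun A => if x ∈ A then 1 else 0)
      (fun β => ∑ δ ∈ P.powerset, q ^ apExp P δ * (splitInd y z (β ∪ δ) * g (β ∪ δ))) ≤ 0 := by
  have Gsplit : ∀ β : Finset (Sym2 V), β ⊆ M₁ → ∀ δ : Finset (Sym2 V), splitInd y z (β ∪ δ) = splitInd y z δ := fun β hβ δ => by
    have hyβ : y ∉ β := fun h => hyM (hβ h)
    have hzβ : z ∉ β := fun h => hzM (hβ h)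
    unfold splitInd; simp only [Finset.mem_union, hyβ, hzβ, false_or]
  refine hU _ (fun A => Finset.sum_congr rfl fun δ _ => by rw [Finset.insert_union, splitInd_insert_of_ne hxy hxz, hgx]) ?_
  intro A B hAB hB
  refine Finset.sum_le_sum fun δ hδ => ?_
  rw [Gsplit A (hAB.trans hB), Gsplit B hB]
  refine mul_le_mul_of_nonneg_left (mul_le_mul_of_nonneg_left (hmono (Finset.union_subset_union hAB le_rfl)
    (hPM B hB |>.trans' (Finset.union_subset_union le_rfl (Finset.mem_powerset.1 hδ)))) ?_) (pow_nonneg hq _)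
  unfold splitInd; split_ifs <;> norm_num

omit [Fintype V] in
/-- **Split pair ACROSS**: `y` in the core side (`y ∉ P`), `z ∈ P` (`z ∉ M₁`).  The fold is `1{y∈β}·G_out(β) + 1{y∉β}·G_in(β)`; it is
monotone on the subsets of `M₁` because `G_in ≤ G_out` pointwise, which is Theorem U on `P` at `z` (hypothesis `hUz`) via
`FK.apPsi_pivot_eq_two_mul`; then Theorem U on `M₁` at `x` (hypothesis `hUx`). [cite: Grimmett2006, §3.8 Thm. (3.90) (pp. 61–62)] -/
theorem pivot_split_fold_nonpos_across (hq : 0 ≤ q) (hxy : x ≠ y) (hxz : x ≠ z) (hyP : y ∉ P) (hzM : z ∉ M₁) (hzP : z ∈ P)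
    (hPM : ∀ B : Finset (Sym2 V), B ⊆ M₁ → B ∪ P ⊆ M₁ ∪ P)
    (hUx : ∀ h : Finset (Sym2 V) → ℝ, (∀ A : Finset (Sym2 V), h (insert x A) = h A) →
      (∀ ⦃A B : Finset (Sym2 V)⦄, A ⊆ B → B ⊆ M₁ → h A ≤ h B) → apPsi q M₁ (fun A => if x ∈ A then 1 else 0) h ≤ 0)
    (hUz : ∀ g' : Finset (Sym2 V) → ℝ, (∀ A : Finset (Sym2 V), g' (insert z A) = g' A) →
      (∀ ⦃A B : Finset (Sym2 V)⦄, A ⊆ B → B ⊆ P → g' A ≤ g' B) → apPsi q P (fun A => if z ∈ A then 1 else 0) g' ≤ 0)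
    (hgx : ∀ A : Finset (Sym2 V), g (insert x A) = g A) (hgz : ∀ A : Finset (Sym2 V), g (insert z A) = g A)
    (hmono : ∀ ⦃A B : Finset (Sym2 V)⦄, A ⊆ B → B ⊆ M₁ ∪ P → g A ≤ g B) :
    apPsi q M₁ (fun A => if x ∈ A then 1 else 0)
      (fun β => ∑ δ ∈ P.powerset, q ^ apExp P δ * (splitInd y z (β ∪ δ) * g (β ∪ δ))) ≤ 0 := by
  set G : Finset (Sym2 V) → ℝ := fun β => ∑ δ ∈ P.powerset, q ^ apExp P δ * (splitInd y z (β ∪ δ) * g (β ∪ δ)) with hGdef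
  have Gin : ∀ β : Finset (Sym2 V), β ⊆ M₁ → y ∉ β →
      G β = ∑ δ ∈ P.powerset, q ^ apExp P δ * ((if z ∈ δ then (1 : ℝ) else 0) * g (β ∪ δ)) := fun β hβ hyβ => by
    refine Finset.sum_congr rfl fun δ hδ => ?_
    have hyδ : y ∉ δ := fun h => hyP (Finset.mem_powerset.1 hδ h)
    have hzβ : z ∉ β := fun h => hzM (hβ h)
    unfold splitInd
    simp only [Finset.mem_union, hyβ, hyδ, hzβ, or_self, false_or, false_iff, not_not]
  have Gout : ∀ β : Finset (Sym2 V), β ⊆ M₁ → y ∈ β →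
      G β = ∑ δ ∈ P.powerset, q ^ apExp P δ * ((if z ∈ δ then (0 : ℝ) else 1) * g (β ∪ δ)) := fun β hβ hyβ => by
    refine Finset.sum_congr rfl fun δ hδ => ?_
    have hzβ : z ∉ β := fun h => hzM (hβ h)
    unfold splitInd
    simp only [Finset.mem_union, hyβ, hzβ, true_or, false_or, true_iff, ite_not]
  have inout : ∀ β : Finset (Sym2 V), β ⊆ M₁ →
      (∑ δ ∈ P.powerset, q ^ apExp P δ * ((if z ∈ δ then (1 : ℝ) else 0) * g (β ∪ δ))) ≤
        ∑ δ ∈ P.powerset, q ^ apExp P δ * ((if z ∈ δ then (0 : ℝ) else 1) * g (β ∪ δ)) := fun β hβ => by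
    have u := hUz (fun X => g (β ∪ X)) (fun A => by simp only [Finset.union_insert, hgz])
      (fun A B hAB hB => hmono (Finset.union_subset_union le_rfl hAB) (hPM β hβ |>.trans' (Finset.union_subset_union le_rfl hB)))
    rw [apPsi_pivot_eq_two_mul] at u
    have hdiff : (∑ γ ∈ P.powerset, q ^ apExp P γ *
        ((((if z ∈ γ then (1 : ℝ) else 0) - if z ∈ P \ γ then 1 else 0)) * g (β ∪ γ))) =
      (∑ δ ∈ P.powerset, q ^ apExp P δ * ((if z ∈ δ then (1 : ℝ) else 0) * g (β ∪ δ))) -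
        ∑ δ ∈ P.powerset, q ^ apExp P δ * ((if z ∈ δ then (0 : ℝ) else 1) * g (β ∪ δ)) := by
      rw [← Finset.sum_sub_distrib]
      refine Finset.sum_congr rfl fun γ _ => ?_
      have hzc : z ∈ P \ γ ↔ z ∉ γ := by rw [Finset.mem_sdiff]; exact ⟨fun h => h.2, fun h => ⟨hzP, h⟩⟩
      simp only [hzc]
      by_cases c : z ∈ γ <;> simp only [c, not_true_eq_false, not_false_eq_true, if_true, if_false] <;> ring
    rw [hdiff] at u
    linarith
  have Gmono : ∀ ⦃A B : Finset (Sym2 V)⦄, A ⊆ B → B ⊆ M₁ → G A ≤ G B := by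
    intro A B hAB hB
    have hA : A ⊆ M₁ := hAB.trans hB
    have hBP : ∀ δ ∈ P.powerset, B ∪ δ ⊆ M₁ ∪ P := fun δ hδ =>
      hPM B hB |>.trans' (Finset.union_subset_union le_rfl (Finset.mem_powerset.1 hδ))
    have tin : (∑ δ ∈ P.powerset, q ^ apExp P δ * ((if z ∈ δ then (1 : ℝ) else 0) * g (A ∪ δ))) ≤
        ∑ δ ∈ P.powerset, q ^ apExp P δ * ((if z ∈ δ then (1 : ℝ) else 0) * g (B ∪ δ)) :=
      Finset.sum_le_sum fun δ hδ => mul_le_mul_of_nonneg_left (mul_le_mul_of_nonneg_left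
        (hmono (Finset.union_subset_union hAB le_rfl) (hBP δ hδ)) (by split_ifs <;> norm_num)) (pow_nonneg hq _)
    have tout : (∑ δ ∈ P.powerset, q ^ apExp P δ * ((if z ∈ δ then (0 : ℝ) else 1) * g (A ∪ δ))) ≤
        ∑ δ ∈ P.powerset, q ^ apExp P δ * ((if z ∈ δ then (0 : ℝ) else 1) * g (B ∪ δ)) :=
      Finset.sum_le_sum fun δ hδ => mul_le_mul_of_nonneg_left (mul_le_mul_of_nonneg_left
        (hmono (Finset.union_subset_union hAB le_rfl) (hBP δ hδ)) (by split_ifs <;> norm_num)) (pow_nonneg hq _)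
    by_cases hyA : y ∈ A
    · rw [Gout A hA hyA, Gout B hB (hAB hyA)]; exact tout
    by_cases hyB : y ∈ B
    · rw [Gin A hA hyA, Gout B hB hyB]; exact tin.trans (inout B hB)
    · rw [Gin A hA hyA, Gin B hB hyB]; exact tin
  have Gx : ∀ A : Finset (Sym2 V), G (insert x A) = G A := fun A =>
    Finset.sum_congr rfl fun δ _ => by rw [Finset.insert_union, splitInd_insert_of_ne hxy hxz, hgx]
  exact hUx G Gx Gmono

end Folds

/-! ### U¹¹ in every deletion cell -/

/-- **U¹¹ IN EVERY DELETION CELL, pivot at the root** (`0 < q ≤ 1`): `E` TTSP between `s, t`, `x = st ∉ E`, `L ⊆ E` the live set,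
`y ≠ z ∈ L`, `g` monotone on the subsets of `L ∪ {x}` reading none of `x, y, z` ⟹ `apPsi q (L ∪ {x}) 1_x (split_{yz}·g) ≤ 0`.
Proof: `FK.prune` with the context `{x}`; empty core ⇒ the form vanishes (`FK.apPsi_single_eq_zero`); otherwise the three fold lemmas
with gen 16's U¹¹ on the core host `L' ∪ {x}` and Theorem U on the core / on the pruned part (`FK.apPsi_pivot_sub_nonpos_of_isTTSP`).
[cite: Grimmett2006, §3.8 Thm. (3.90) (pp. 61–62); §3.9 (pp. 63–64)] -/
theorem apPsi_pivot_split_del_nonpos_of_isTTSP {q : ℝ} (hq0 : 0 < q) (hq1 : q ≤ 1) {E : Finset (Sym2 V)} (hE : IsTTSP E s t)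
    (hst : s(s, t) ∉ E) {L : Finset (Sym2 V)} (hL : L ⊆ E) {y z : Sym2 V} (hy : y ∈ L) (hz : z ∈ L) (hyz : y ≠ z)
    {g : Finset (Sym2 V) → ℝ} (hgx : ∀ A : Finset (Sym2 V), g (insert s(s, t) A) = g A)
    (hgy : ∀ A : Finset (Sym2 V), g (insert y A) = g A) (hgz : ∀ A : Finset (Sym2 V), g (insert z A) = g A)
    (hmono : ∀ ⦃A B : Finset (Sym2 V)⦄, A ⊆ B → B ⊆ insert s(s, t) L → g A ≤ g B) :
    apPsi q (insert s(s, t) L) (fun A => if s(s, t) ∈ A then 1 else 0) (fun A => splitInd y z A * g A) ≤ 0 := by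
  set x := s(s, t) with hxdef
  have hxL : x ∉ L := fun h => hst (hL h)
  have hxy : x ≠ y := fun h => hxL (h ▸ hy)
  have hxz : x ≠ z := fun h => hxL (h ▸ hz)
  obtain ⟨L', hL', hT, hnr, hF⟩ := prune hq0.ne' hE L hL
  have hxL' : x ∉ L' := fun h => hxL (hL' h)
  -- the context {x}
  have cd : Disjoint ({x} : Finset (Sym2 V)) E := Finset.disjoint_singleton_left.2 hst
  have cs : ∀ e ∈ (↑({x} : Finset (Sym2 V)) : Set (Sym2 V)), ∀ v ∈ e, v ∈ ({s, t} : Set V) := by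
    intro e he v hv
    rw [Finset.coe_singleton, Set.mem_singleton_iff] at he
    subst he
    rcases Sym2.mem_iff.1 hv with rfl | rfl
    · exact Or.inl rfl
    · exact Or.inr rfl
  have ci : ({s, t} : Set V) ∩ {v : V | ∃ e ∈ E, v ∈ e} ⊆ {s, t} := fun v hv => hv.1
  have hf : ∀ X Y : Finset (Sym2 V), Y ⊆ L \ L' →
      (fun A : Finset (Sym2 V) => if x ∈ A then (1 : ℝ) else 0) (X ∪ Y) = (fun A : Finset (Sym2 V) => if x ∈ A then (1 : ℝ) else 0) X :=
    fun X Y hY => by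
      have hxY : x ∉ Y := fun h => hxL ((hY.trans Finset.sdiff_subset) h)
      simp only [Finset.mem_union, hxY, or_false]
  have key := hF {x} {s, t} cd cs ci (fun A => if x ∈ A then (1 : ℝ) else 0) hf (fun A => splitInd y z A * g A)
  rw [← Finset.insert_eq, ← Finset.insert_eq] at key
  have hPM : ∀ B : Finset (Sym2 V), B ⊆ insert x L' → B ∪ (L \ L') ⊆ insert x L' ∪ (L \ L') := fun B hB =>
    Finset.union_subset_union hB le_rfl
  have hhost : insert x L' ∪ (L \ L') = insert x L := by
    rw [Finset.insert_union, Finset.union_sdiff_of_subset hL']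
  have hmono' : ∀ ⦃A B : Finset (Sym2 V)⦄, A ⊆ B → B ⊆ insert x L' ∪ (L \ L') → g A ≤ g B := by
    rw [hhost]; exact hmono
  suffices hle : apPsi q (insert x L') (fun A => if x ∈ A then 1 else 0)
      (fun β => ∑ δ ∈ (L \ L').powerset, q ^ apExp (L \ L') δ * (splitInd y z (β ∪ δ) * g (β ∪ δ))) ≤ 0 by
    rw [← key] at hle
    exact le_of_mul_le_mul_left (by rw [mul_zero]; exact hle) (pow_pos hq0 _)
  rcases hT with hT | hT
  · -- nonempty core: Theorem U on the core host at x, and on the pruned part at any of its edges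
    have hUx : ∀ h : Finset (Sym2 V) → ℝ, (∀ A : Finset (Sym2 V), h (insert x A) = h A) →
        (∀ ⦃A B : Finset (Sym2 V)⦄, A ⊆ B → B ⊆ insert x L' → h A ≤ h B) →
        apPsi q (insert x L') (fun A => if x ∈ A then 1 else 0) h ≤ 0 := fun h hhx hhm =>
      apPsi_pivot_sub_nonpos_of_isTTSP hq0 hq1 hE hst (Finset.insert_subset_insert _ (hL'.trans hL))
        (Finset.mem_insert_self _ _) hhx hhm
    have hUP : ∀ w : Sym2 V, w ∈ L \ L' → ∀ g' : Finset (Sym2 V) → ℝ, (∀ A : Finset (Sym2 V), g' (insert w A) = g' A) →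
        (∀ ⦃A B : Finset (Sym2 V)⦄, A ⊆ B → B ⊆ L \ L' → g' A ≤ g' B) →
        apPsi q (L \ L') (fun A => if w ∈ A then 1 else 0) g' ≤ 0 := fun w hw g' hg' hm' =>
      apPsi_pivot_sub_nonpos_of_isTTSP hq0 hq1 hE hst
        (Finset.sdiff_subset.trans (hL.trans (Finset.subset_insert _ _))) hw hg' hm'
    by_cases hyL' : y ∈ L'
    · by_cases hzL' : z ∈ L'
      · -- both marked edges in the core: gen 16's U¹¹ on the smaller host
        have hyP : y ∉ L \ L' := fun h => (Finset.mem_sdiff.1 h).2 hyL'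
        have hzP : z ∉ L \ L' := fun h => (Finset.mem_sdiff.1 h).2 hzL'
        exact pivot_split_fold_nonpos_core hq0.le hyP hzP hPM
          (fun h hx' hy' hz' hm' => apPsi_pivot_split_nonpos_of_isTTSP hq0 hq1 hT hxL' (Finset.mem_insert_self _ _)
            (Finset.mem_insert_of_mem hyL') (Finset.mem_insert_of_mem hzL') hxy hxz hyz hx' hy' hz' hm')
          hgx hgy hgz hmono'
      · -- y in the core, z pruned
        have hyP : y ∉ L \ L' := fun h => (Finset.mem_sdiff.1 h).2 hyL'
        have hzP : z ∈ L \ L' := Finset.mem_sdiff.2 ⟨hz, hzL'⟩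
        have hzM : z ∉ insert x L' := fun h => by
          rcases Finset.mem_insert.1 h with h | h
          · exact hxz h.symm
          · exact hzL' h
        exact pivot_split_fold_nonpos_across hq0.le hxy hxz hyP hzM hzP hPM hUx (hUP z hzP) hgx hgz hmono'
    · by_cases hzL' : z ∈ L'
      · -- z in the core, y pruned: swap the marked edges
        have hzP : z ∉ L \ L' := fun h => (Finset.mem_sdiff.1 h).2 hzL'
        have hyP : y ∈ L \ L' := Finset.mem_sdiff.2 ⟨hy, hyL'⟩
        have hyM : y ∉ insert x L' := fun h => by
          rcases Finset.mem_insert.1 h with h | h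
          · exact hxy h.symm
          · exact hyL' h
        have hswap : (fun β : Finset (Sym2 V) => ∑ δ ∈ (L \ L').powerset, q ^ apExp (L \ L') δ *
            (splitInd y z (β ∪ δ) * g (β ∪ δ))) =
            fun β => ∑ δ ∈ (L \ L').powerset, q ^ apExp (L \ L') δ * (splitInd z y (β ∪ δ) * g (β ∪ δ)) := by
          funext β; exact Finset.sum_congr rfl fun δ _ => by rw [splitInd_comm]
        rw [hswap]
        exact pivot_split_fold_nonpos_across hq0.le hxz hxy hzP hyM hyP hPM hUx (hUP y hyP) hgx hgy hmono'
      · -- both marked edges pruned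
        have hyM : y ∉ insert x L' := fun h => by
          rcases Finset.mem_insert.1 h with h | h
          · exact hxy h.symm
          · exact hyL' h
        have hzM : z ∉ insert x L' := fun h => by
          rcases Finset.mem_insert.1 h with h | h
          · exact hxz h.symm
          · exact hzL' h
        exact pivot_split_fold_nonpos_far hq0.le hxy hxz hyM hzM hPM hUx hgx hmono'
  · -- empty core: the folded form on the one-edge host {x} vanishes
    subst hT
    rw [Finset.insert_empty]
    refine le_of_eq (apPsi_single_eq_zero q x _ ?_)
    refine Finset.sum_congr rfl fun δ _ => ?_
    rw [Finset.empty_union, ← Finset.insert_eq, splitInd_insert_of_ne hxy hxz, hgx]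

/-- **U¹¹ IN EVERY DELETION CELL, any pivot** (`0 < q ≤ 1`): `M ⊆ E ∪ {st}` a live sub-host, `a, b, c ∈ M` distinct, `g` monotone on the
subsets of `M` reading none of `a, b, c` ⟹ `apPsi q M 1_a (split_{bc}·g) ≤ 0` — every square-free coefficient of
`Z_H² Cov_{φ_{z,q}}(ω_a, split_{bc}·g)` on a 2-connected series–parallel graph (re-root at `a`, then `FK.apPsi_pivot_split_del_nonpos_of_isTTSP`).
[cite: Grimmett2006, §3.8 Thm. (3.90) (pp. 61–62); §3.9 (pp. 63–64)] [cite: Wagner2006, Thm. 5.8(d), §5.3] -/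
theorem apPsi_pivot_split_sub_nonpos_of_isTTSP {q : ℝ} (hq0 : 0 < q) (hq1 : q ≤ 1) {E : Finset (Sym2 V)} (hE : IsTTSP E s t)
    (hst : s(s, t) ∉ E) {M : Finset (Sym2 V)} (hM : M ⊆ insert s(s, t) E) {a b c : Sym2 V} (ha : a ∈ M) (hb : b ∈ M) (hc : c ∈ M)
    (hab : a ≠ b) (hac : a ≠ c) (hbc : b ≠ c) {g : Finset (Sym2 V) → ℝ}
    (hga : ∀ A : Finset (Sym2 V), g (insert a A) = g A) (hgb : ∀ A : Finset (Sym2 V), g (insert b A) = g A)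
    (hgc : ∀ A : Finset (Sym2 V), g (insert c A) = g A)
    (hmono : ∀ ⦃A B : Finset (Sym2 V)⦄, A ⊆ B → B ⊆ M → g A ≤ g B) :
    apPsi q M (fun A => if a ∈ A then 1 else 0) (fun A => splitInd b c A * g A) ≤ 0 := by
  induction a using Sym2.ind with
  | h a₁ a₂ =>
    have hR := hE.reroot_erase (hM ha) (insert_ne_singleton_of_isTTSP hE hst _)
    have hMa : M.erase s(a₁, a₂) ⊆ (insert s(s, t) E).erase s(a₁, a₂) := Finset.erase_subset_erase _ hM
    have key := apPsi_pivot_split_del_nonpos_of_isTTSP hq0 hq1 hR (Finset.notMem_erase _ _) hMa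
      (Finset.mem_erase.2 ⟨hab.symm, hb⟩) (Finset.mem_erase.2 ⟨hac.symm, hc⟩) hbc hga hgb hgc
      (fun A B hAB hB => hmono hAB (by rw [Finset.insert_erase ha] at hB; exact hB))
    rw [Finset.insert_erase ha] at key
    exact key

end FK

end Summit.CriticalPhenomena.PercolationContinuityZ3.Theorems

end
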